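import Summits.ResolutionOfSingularities.ResolutionOfSingularities.Theorems.FreezeCutDead
import HarnessLib

/-!
# FreezeCutDead2 — decomp-res node «ExtinctionCut» (lens-3 g20, critic row 156), tree file 2/8 of the node

Content VERBATIM from the decomp-res lens-3 g20 node `HOME/decomp-res-lens-3/g20/ExtinctionCut.lean` (pin c917c20b =
`parts/ExtinctionCut-g20-c917c20b.lean`, 1 323 l; HOME = run/shared/lean/pub/decomp-res; lens imports = tree
`MaxContactCutFreezeCut` +
`StallVertexStraightClasses` only; rc 0 · 0 sorry).  Critic: CRITIC-LEDGER row 156 (2026-08-31T00:18:27Z):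
DECIDED-MOD-PORT +1 — the BALANCED
BOUNDARY CLASS `FreezeCut.NoBalancedBoundaryTailsDeep` decided AS A WHOLE modulo ONE typed port
`ExtinctionCut.KollarWallPort`.  Landing orders
INBOX :552 (critic) and :467 / :489 (the lens-3 g19 rev-4 blocks §D / §K7 = `FreezeCutDead` + classes add-on, land
first), `--kind proof --supports
stmt-ResolutionOfSingularities-31770` (`MaxContactCut.DefectWalksDeep`).  Files of the node, in import order:
`FreezeCutDead` (§D, namespace
`…HoleCut.TailShade`, over the in-cone `MaxContactCutFreezeCut`) · `FreezeCutDeadClasses` (§K7 classes, cone-free,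
namespace `…FreezeCut`) ·
`MaxContactCutFreezeCutDead` (§K7 kernels and EXACT iff's at 31770, Theses cone) · `ExtinctionCutToric` /
`ExtinctionCutToric2` (§1, Mathlib only,
namespace `…ExtinctionCut`) · `ExtinctionCutPort` (§2, the ONE typed port `KollarWallPort`, cone-free so that the
route file can cite it as an item) ·
`MaxContactCutExtinctionCut` (§3 booking at 31770, Theses cone; §M `closes` = tree
`MaxContactCutExponentLadder.closes` verbatim is omitted, as in
`MaxContactCutFreezeCut`).  Aside bookkeeping (row 156 / INBOX :552): on the lens-3 column ONE typed PORT item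
`KollarWallPort` and ONE live aside
`FreezeCut.NoSmallDeadStrictHighSkewJointTailsDeep` (home `FreezeCutDeadClasses`) superseding the rev-4 sub-class
pair; decided cells are THEOREMS and
are not filed.

## This file

§D continued (second part of `section DeadLaw`, `namespace TailShade`): see `FreezeCutDead`.  Imports `FreezeCutDead`.

[WRITER NOTE (decomp-res writer g9): file split only (tree files ≤ 400 lines); namespaces, sections, section
variables and every declaration
exactly as in the lens (the lens's global opens are replayed per file; cone-free files carry the opens of
`FreezeCutClasses.lean`, the toric kernel none).]

(Sources: Kollar2007 (Lectures on Resolution of Singularities: Thm 1.93, Def 2.56, Rem 2.57, Claim 2.59.1, (2.59.2),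
Claim 2.59.4) [corpus:book:kollar2007-lectures-resolution-singularities pp. 54, 92–94]; Hauser2010Kangaroo
(arXiv:0811.4151); Moh1987; CossartPiltant2008 §2; CossartPiltant2019 Prop. 2.50; HauserPerlega2019 §1.)
-/

noncomputable section

open MvPolynomial Finset
open Literature.AlgebraicGeometry.Resolution
open Literature.AlgebraicGeometry.Resolution.Hauser2010
open Literature.AlgebraicGeometry.Resolution.PointBlowup
open Summit.ResolutionOfSingularities.ResolutionOfSingularities.Theses
open Summit.ResolutionOfSingularities.ResolutionOfSingularities.Theorems.TightDefectClasses
open Summit.ResolutionOfSingularities.ResolutionOfSingularities.Theorems.TightDefectStrongWalks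
open Summit.ResolutionOfSingularities.ResolutionOfSingularities.Theorems.ItineraryCutClasses
open Summit.ResolutionOfSingularities.ResolutionOfSingularities.Theorems.BoundaryLedger
open Summit.ResolutionOfSingularities.ResolutionOfSingularities.Theorems.ProximityCut
open Summit.ResolutionOfSingularities.ResolutionOfSingularities.Theorems.ConeCutAxisLaw
open Literature.AlgebraicGeometry.Resolution.WeightedBlowup
open Literature.Barriers.ResolutionOfSingularities
open Summit.ResolutionOfSingularities.ResolutionOfSingularities.Theorems.FloorCut
open Summit.ResolutionOfSingularities.ResolutionOfSingularities.Theorems.ConeCut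
open Summit.ResolutionOfSingularities.ResolutionOfSingularities.Theorems.ExitLaw (fin3_cases eq_of_le_of_degree_le)
open Summit.ResolutionOfSingularities.ResolutionOfSingularities.Theorems.ShadeCut
open Summit.ResolutionOfSingularities.ResolutionOfSingularities.Theorems.TightCut
open Summit.ResolutionOfSingularities.ResolutionOfSingularities.Theorems.HoleCut

namespace Summit.ResolutionOfSingularities.ResolutionOfSingularities.Theorems.HoleCut

section DeadLaw

variable {K : Type} [Field K] [DecidableEq K] {q : ℕ} {s₀ : State (Fin 3) K}

namespace TailShade

variable {W : ForcedWalk q s₀} {N n : ℕ}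

/-- (D7a) THE SHAPE OF A CONSTANT-MASS MOVE on the boundary line: at a small stage `t` with a dead support whose
move keeps the boundary mass `D`, ONE coordinate `i ≠ j_t` is untranslated of multiplicity `n − 1` before and after
the move, the newest multiplicity is `D + 1 − n`, and the third coordinate dies. [new] [folklore] -/
theorem boundary_shape (hroot : IsRoot q s₀) (hq : q + 1 = 2 * n) (hn2 : 2 ≤ n) (h : TailShade W N n) (t : ℕ)
    (ht : N ≤ t) (hs : ∀ y, (W.st t).r y + 1 ≤ n) (hd : ∃ x, DeadSupport W t x)
    (hD : (W.st (t + 1)).r.degree = (W.st t).r.degree) :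
    ∃ i, i ≠ W.j t ∧ W.b t i = 0 ∧ (W.st t).r i + 1 = n ∧ (W.st (t + 1)).r i + 1 = n ∧
      (W.st (t + 1)).r (W.j t) + n = (W.st t).r.degree + 1 ∧
      ∀ m, m ≠ W.j t → m ≠ i → (W.st (t + 1)).r m = 0 := by
  classical
  obtain ⟨x, hcx, hrx⟩ := hd
  obtain ⟨hdeg, hnew, hkeep⟩ := h.step hroot t ht
  obtain ⟨o, ho, hqo, hplat, hn, -⟩ := h.stage hroot t ht
  -- a coordinate `z ≠ j_t` keeping nothing
  obtain ⟨z, hzj, hz0⟩ : ∃ z, z ≠ W.j t ∧ kept W t z = 0 := by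
    by_cases hxj : x = W.j t
    · have hb : W.b t ≠ 0 := by
        intro hb
        refine not_coneVar_chart_of_untranslated hroot W t ho hqo hplat hn hb ?_
        rw [← hxj]
        exact hcx
      obtain ⟨z, hbz⟩ : ∃ z, W.b t z ≠ 0 := by
        by_contra hall
        push Not at hall
        exact hb (funext fun l => hall l)
      have hzj : z ≠ W.j t := by
        intro h'
        rw [h'] at hbz
        exact hbz (W.onExc t)
      exact ⟨z, hzj, by rw [kept_of_ne W t hzj, if_neg hbz]⟩
    · refine ⟨x, hxj, ?_⟩
      have := kept_le W t x
      omega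
  obtain ⟨i, hij, hiz⟩ := exists_third hzj.symm
  have hkd : (kept W t).degree = kept W t i := by
    rw [degree_eq_three (kept W t) hzj.symm hij hiz, kept_chart W t, hz0, zero_add, zero_add]
  have hki : kept W t i + 1 = n := by omega
  have hri : (W.st t).r i + 1 = n := by
    have h1 := kept_le W t i
    have h2 := hs i
    omega
  have hbi : W.b t i = 0 := by
    by_contra hbi
    rw [kept_of_ne W t hij, if_neg hbi] at hki
    omega
  refine ⟨i, hij, hbi, hri, ?_, by omega, ?_⟩
  · rw [hkeep i hij]
    exact hki
  · intro m hmj hmi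
    have hmz : m = z := by
      rcases fin3_cases hzj.symm hij hiz m with hl | hl | hl
      · exact absurd hl hmj
      · exact hl
      · exact absurd hl hmi
    rw [hkeep m hmj, hmz, hz0]

/-- **(D7) THE BALANCE LAW ON THE BOUNDARY LINE (PROVED).**  On a skew joint tail of shade `n ≥ 2` with
`q + 1 = 2n`, from some stage on the boundary mass is `q − 1` and the multiplicity vector is a permutation of
`(0, n − 1, n − 1)`: the walk is eventually BALANCED (kernel form of the universal balanced cycle of the shadow
automaton at `(5,3), (7,4), (9,5), (11,6), (13,7)`).  Mechanism: by D6/D7a every late move has the constant-mass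
shape; were the newest multiplicity `D + 1 − n` not `n − 1`, the heavy coordinate `i` of D7a would be the same at
every stage, never charted and never translated — a planar letter, against skewness. [new] [folklore] -/
theorem balanced_of_skew (hroot : IsRoot q s₀) (hq : q + 1 = 2 * n) (hn2 : 2 ≤ n) (h : TailShade W N n)
    (hrep : ∀ M, ∃ t, M ≤ t ∧ StaysOnNewest W t) (htr : ∀ M, ∃ t, M ≤ t ∧ W.b t ≠ 0)
    (hskew : ∀ (k : Fin 3) (N' : ℕ), ∃ t, N' ≤ t ∧ (W.j t = k ∨ W.b t k ≠ 0)) :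
    ∃ M, N ≤ M ∧ ∀ t, M ≤ t → (W.st t).r.degree + 1 = q ∧ (∃ x, DeadSupport W t x) ∧
      ∃ x, (W.st t).r x = 0 ∧ ∀ y, y ≠ x → (W.st t).r y + 1 = n := by
  classical
  obtain ⟨M, hM, hsd, hconst⟩ := h.eventually_const_degree_of_skew hroot hq (by omega) hrep htr hskew
  have hshape : ∀ t, M ≤ t → ∃ i, i ≠ W.j t ∧ W.b t i = 0 ∧ (W.st t).r i + 1 = n ∧
      (W.st (t + 1)).r i + 1 = n ∧ (W.st (t + 1)).r (W.j t) + n = (W.st M).r.degree + 1 ∧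
      ∀ m, m ≠ W.j t → m ≠ i → (W.st (t + 1)).r m = 0 := by
    intro t ht
    have := h.boundary_shape hroot hq hn2 t (by omega) (hsd t ht).1 (hsd t ht).2
      (by rw [hconst (t + 1) (by omega), hconst t ht])
    rw [hconst t ht] at this
    exact this
  -- the constant mass is `q − 1`: otherwise the heavy coordinate is frozen, against skewness
  have hDq : (W.st M).r.degree + 1 = q := by
    by_contra hDq
    obtain ⟨c, hcj, hbc, -, hc1, -, -⟩ := hshape M le_rfl
    have hinv : ∀ t, M ≤ t → W.j t ≠ c ∧ W.b t c = 0 ∧ (W.st (t + 1)).r c + 1 = n := by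
      intro t ht
      induction t, ht using Nat.le_induction with
      | base => exact ⟨hcj.symm, hbc, hc1⟩
      | succ t ht ih =>
        obtain ⟨hjc, -, hc⟩ := ih
        obtain ⟨i, hij, -, -, -, hjn, hm⟩ := hshape t ht
        -- `c` is the heavy coordinate of the move at `t`
        have hic : i = c := by
          by_contra hic
          have := hm c (fun h' => hjc h'.symm) (fun h' => hic h'.symm)
          omega
        -- the heavy coordinate of the move at `t + 1` has multiplicity `n − 1` at stage `t + 1`: it is `c` again
        obtain ⟨i', hi'j, hbi', hri', hi'1, -, -⟩ := hshape (t + 1) (by omega)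
        have hi'c : i' = c := by
          by_contra hi'c
          by_cases hi'jt : i' = W.j t
          · rw [hi'jt] at hri'
            omega
          · have := hm i' hi'jt (fun h' => hi'c (h'.trans hic))
            omega
        refine ⟨fun h' => hi'j (hi'c.trans h'.symm), ?_, ?_⟩
        · rw [← hi'c]; exact hbi'
        · rw [← hi'c]; exact hi'1
    obtain ⟨t, hMt, ht⟩ := hskew c M
    obtain ⟨hj, hb, -⟩ := hinv t hMt
    rcases ht with ht | ht
    · exact hj ht
    · exact ht hb
  refine ⟨M + 1, by omega, ?_⟩
  intro t ht
  obtain ⟨u, rfl⟩ : ∃ u, t = u + 1 := ⟨t - 1, by omega⟩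
  obtain ⟨i, hij, -, -, hi1, hjn, hm⟩ := hshape u (by omega)
  obtain ⟨x, hxj, hxi⟩ := exists_third hij.symm
  refine ⟨by rw [hconst (u + 1) (by omega)]; exact hDq, (hsd (u + 1) (by omega)).2, x, hm x hxj hxi, ?_⟩
  intro y hy
  rcases fin3_cases hij.symm hxj hxi y with hl | hl | hl
  · rw [hl]; omega
  · rw [hl]; exact hi1
  · exact absurd hl hy

end TailShade

end DeadLaw

end Summit.ResolutionOfSingularities.ResolutionOfSingularities.Theorems.HoleCut
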